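import Summits.HodgeConjecture.HodgeConjecture.Theses.SignSymmetricPowers
import Literature.RepresentationTheory.ClassicalInvariants.SymplecticInvolutionTensorFFT

/-!
# K2 algebra step (route `SignSymmetricPowers`, item stmt-HodgeConjecture-19717) — the `Sp(V₊) × Sp(V₋)` tensor FFT

Discharges the registered stub `stub_fftTensorPort` (skeleton `c9b6e0189417`, K2 line `kunneth-tensor-fft`,
active stubs `stub_fftTensorPort`, `stub_fultonPullback`, `stub_kunnethHodgeTensors`,
`stub_matchingClassesAlgebraic`) of the deciding crux `PowersHodgeOfSignCommutators` (rank 3) of route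
`route-HodgeConjecture-SignSymmetricPowers`; landed `--supports stmt-HodgeConjecture-19717` (it does not close the
item: stubs K and A remain).  Sorry-free; axioms `propext`, `Classical.choice`, `Quot.sound`.

## Statement

`stub_fftTensorPort` — the registered signature VERBATIM: on a finite-dimensional symplectic `ℚ`-space `(V, B)`
with an isometric involution `s`, every covariant tensor `t ∈ T^(r,0) V` (`hodgeTensorSpace V r 0`) fixed under
`tensorSpaceAct g` for all `B`-isometries `g` commuting with `s` lies in the `ℚ`-span of the MATCHING TENSORS:
complete pairings `e : Fin r ≃ Fin 2 × Fin j` of the slots with tags `τ : Fin j → Bool`, pair `l` filled with the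
Casimir element of `B` on the `±1`-eigenspace of its tag (coordinates in `Module.finBasis ℚ V`:
`Θ_ε = [½(1 ± s)]_b · G_b(B)⁻¹`, coefficient `taggedContraction Θ e τ`).

## Proof

`Literature.RepresentationTheory.ClassicalInvariants.fftTensorPort` (p504206, littype-FH1-1 g6: Goodman–Wallach
GTM 255 Thm. 5.3.3 (2) / Thm. 5.3.5, Prop. 4.2.5, §11.3.5 Type CII (11.10); the port of the coefficient-tensor FFT
`SymplecticTensorFFTBlockDiagonal` (p476613) to `hodgeTensorSpace` / `tensorSpaceAct` in a non-adapted basis)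
states exactly this; the `open … in` prefix of the registered signature binds nothing used.
-/

noncomputable section

namespace Summit.HodgeConjecture.HodgeConjecture.Theorems.SignSymmetricPowersFFTTensorPort

/-- **K2 stub F** (`FFTTensorPort`, registered signature verbatim): the first fundamental theorem for
`Sp(V₊) × Sp(V₋)` on covariant tensors — centraliser-fixed tensors are spanned by the matching tensors.
Proof: the Literature theorem `fftTensorPort` (Goodman–Wallach GTM 255, Thm. 5.3.3 (2), Thm. 5.3.5, Prop. 4.2.5,
§11.3.5 (11.10)). -/
theorem stub_fftTensorPort :
    open Literature.AlgebraicGeometry.Motives Literature.AlgebraicGeometry.HodgeTheory Literature.AlgebraicGeometry.HodgeTheory.BettiUniverse CategoryTheory.Limits in ∀ (V : Type) [AddCommGroup V] [Module ℚ V] [Module.Finite ℚ V] (B : LinearMap.BilinForm ℚ V), B.IsAlt → B.Nondegenerate → ∀ (s : V →ₗ[ℚ] V), s ^ 2 = 1 → (∀ x y, B (s x) (s y) = B x y) → ∀ (r : ℕ) (t : hodgeTensorSpace V r 0), (∀ g : V ≃ₗ[ℚ] V, (∀ x, g (s x) = s (g x)) → (∀ x y, B (g x) (g y) = B x y) → tensorSpaceAct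 g t = t) → t ∈ Submodule.span ℚ {m : hodgeTensorSpace V r 0 | ∃ (j : ℕ) (e : Fin r ≃ Fin 2 × Fin j) (τ : Fin j → Bool), m = (∑ w : Fin r → Fin (Module.finrank ℚ V), Literature.RepresentationTheory.ClassicalInvariants.taggedContraction (fun ε : Bool => LinearMap.toMatrix (Module.finBasis ℚ V) (Module.finBasis ℚ V) (Literature.LinearAlgebra.Alternating.halfProj (if ε then s else -s)) * (Matrix.of fun i i' => B ((Module.finBasis ℚ V) i) ((Module.finBasis ℚ V) i'))⁻¹) e τ w • ((PiTensorProduct.tprod ℚ fun i => (Module.finBasis ℚ V) (w i)) ⊗ₜ[ℚ] (PiTensorProduct.tprod ℚ fun i : Fin 0 => (Fin.elim0 i : Module.Dual ℚ V))))} :=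
  Literature.RepresentationTheory.ClassicalInvariants.fftTensorPort

end Summit.HodgeConjecture.HodgeConjecture.Theorems.SignSymmetricPowersFFTTensorPort

end
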